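import Summits.QuantumFields.YangMills.Theorems.UnitScaleTiltProp7NestedMeanParallelLiftDiagSplit
import Summits.QuantumFields.YangMills.Theorems.UnitScaleTiltProp7SymCentreOfDiagonalSupplier
import Summits.QuantumFields.YangMills.Theorems.UnitScaleTiltProp7SymCentreCentralGauge
import HarnessLib

/-!
# Route `UnitScaleTilt`, crux K1 child «MinimiserStabilityRegPr» (stmt-QuantumFields-19200), stub `stub_existenceMinimalOrbit` (EX), line «SYM-CENTRE»
# (★★OWNER RULING g28-№7 cure (ii-a); px20 g2 (R4) assembly plan 22:30:05Z) — **`hSymCentre` FROM AN ABELIAN-ONLY SUPPLIER: the displayed row's ∃-body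
# for EVERY small-plaquette coarse field with a regular fibre point follows from a supplier that only treats σ₃-DIAGONAL coarse fields all of whose parallel
# sections are constant diagonal matrices (the genuine `p = 1` stratum) — and that supplier may return just a DIAGONAL regular fibre point, `hLift` being
# automatic**

Cell `ym3-torus`, width seat `ym3-torus-px6` (gen 3; named fallback pen of the (R4) assembly).  THEOREMS ONLY (0 `def`, 0 `sorry`).
`--supports stmt-QuantumFields-19200 --as helper`, count-neutral.  YM₃ on T³ is a ladder rung (R3), not the Clay problem; nothing here claims the stub, the
crux, d = 4 or the mass gap.

THE POINT.  Composition, by name, of the landed frame ✓`exists_symCentre_of_diagonalSupplier` (✓p674425: irreducible∕re-gauge∕undo), the second split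
✓`parallelConstDiag_or_loopHol_central` (✓p674795) inside the diagonal stratum, the central branch ✓`exists_symCentre_of_loopHol_central` (w2-19936 g9,
Z2-NORMAL-FORM ∘ ✓`exists_symCentre_of_central_gauge`), and the fine-level bridge ✓`hLift_of_mem_fibre_of_parallelConstDiag` (✓p674795 ∘ ✓p673591).  What is
LEFT for the line's content ((R3) smoothed exact lift ★px19, FLUX-LIFT ★w5 g8, R4-FIBRE w4-20520 g9, R4-DICT ★px19, assembly ★px20) is exactly the hypothesis
`hSup` of §2: for a σ₃-diagonal `V′` in case A with `PlaqSmall δ V′`, a DIAGONAL `U₁ ∈ fibre V′` with `RegPr a′ U₁`.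
* §1 ★★★`exists_symCentre_of_abelianSupplier` — supplier returns `U₁ ∈ fibre V′ ∧ RegPr a′ U₁ ∧ hLift U₁` for diagonal case-A `V′`.
* §2 ★★★`exists_symCentre_of_diagonalLiftSupplier` — supplier returns only a σ₃-diagonal `U₁ ∈ fibre V′ ∧ RegPr a′ U₁` (`10⁷L³a′ ≤ 1`); `hLift` by the bridge.
HONEST SCOPE.  A composition of landed theorems; no estimate; the supplier hypothesis IS the open content of the line; no stub ∕ crux statement is advanced.

References: T. Bałaban, CMP 102 (1985) 277–309 [Balaban1985Variational] ((2)–(7) p.278, (13)–(14) p.280); CMP 99 (1985) 389–434 [Balaban1985BackgroundPropagators]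
((3.19)–(3.21) pp.393–394); CMP 98 (1985) 17–51 [Balaban1985Averaging] ((8)–(13) p.19); CMP 109 (1987) 249–301 [Balaban1987RG1] ((0.4), (0.11) p.253).
-/

set_option autoImplicit false

noncomputable section

open scoped BigOperators Matrix.Norms.L2Operator Matrix

namespace Summit.QuantumFields.YangMills.Theorems.Prop7NestedMeanParallelLiftDiagGauge

open Literature.MathematicalPhysics.QuantumFieldTheory.Balaban1983to89
open T4Continuum BlockAveraging
open B10Eq27TorusAxialLog (unitsField toUField)
open B15DeterminingSets (embIter)
open B9AdOrthogonal (σ₃)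
open Summit.QuantumFields.YangMills.Theorems.Prop8Chart (emlIterU)
open Literature.MathematicalPhysics.QuantumFieldTheory.Balaban1983to89.T3ContinuumYM3Torus
open T3UnitLawDensityEML (ℰp)
open T3ConstrainedMinimiser (fibre)
open T3PrintedRegularMinimiser (RegPr)
open T3SectALandauChart (bgUnits CloseAvg)
open Summit.QuantumFields.YangMills.Theorems.Prop7SymCentreCentralGauge (exists_symCentre_of_loopHol_central)

section T3

variable (F : T3Family) {n K : ℕ}

/-! ## §1 The abelian-only supplier -/

/-- ★★★ **`hSymCentre` FROM AN ABELIAN-ONLY SUPPLIER.**  Suppose that for every σ₃-diagonal coarse `V′` ALL of whose `V′♭`-parallel sections are constant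
matrices commuting with `σ₃` (case A of ✓`parallelConstDiag_or_loopHol_central`) and with `PlaqSmall δ V′` a fibre point `U₁` with `RegPr a′ U₁` and
`hLift U₁` is supplied.  Then for every coarse `V` with `PlaqSmall δ V` (`δ ≤ 2`) and every `U₀ ∈ fibre V` with `RegPr a U₀` (`10⁷L³a ≤ 1`, `a ≤ a′`) there is
`U₁ ∈ fibre V` with `RegPr a′ U₁`, `CloseAvg b V U₁` (any `b > 0`) and `hLift U₁` (case B of the diagonal stratum goes through the central branch
✓`exists_symCentre_of_loopHol_central`). [cite: Balaban1985Variational, (2)-(7) p.278, (13)-(14) p.280; Balaban1985BackgroundPropagators, (3.21) p.394] -/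
theorem exists_symCentre_of_abelianSupplier (h : n ≤ K) {δ a a' b : ℝ} (hδ : δ ≤ 2) (ha : 0 < a) (haW : 10 ^ 7 * (F.L : ℝ) ^ 3 * a ≤ 1) (haa' : a ≤ a')
    (hb : 0 < b)
    (hSup : ∀ V' : GaugeField (F.P n) 0 (Matrix.specialUnitaryGroup (Fin 2) ℂ),
      (∀ e : PBond (F.P n) 0, Commute ((V' e : Matrix.specialUnitaryGroup (Fin 2) ℂ) : Matrix (Fin 2) (Fin 2) ℂ) σ₃) →
      (∀ c : Site (F.P n) 0 → Matrix (Fin 2) (Fin 2) ℂ,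
        (∀ e : PBond (F.P n) 0, c e.src = ((unitsField (toUField V') e : (Matrix (Fin 2) (Fin 2) ℂ)ˣ) : Matrix (Fin 2) (Fin 2) ℂ) * c e.tgt *
          (((unitsField (toUField V') e)⁻¹ : (Matrix (Fin 2) (Fin 2) ℂ)ˣ) : Matrix (Fin 2) (Fin 2) ℂ)) →
        ∃ c₀ : Matrix (Fin 2) (Fin 2) ℂ, (∀ y, c y = c₀) ∧ Commute c₀ σ₃) →
      PlaqSmall δ V' →
      ∃ U₁ : GaugeField (F.P K) 0 (Matrix.specialUnitaryGroup (Fin 2) ℂ), U₁ ∈ fibre F ℰp n K h V' ∧ RegPr F n K a' U₁ ∧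
        ∀ cf : Site (F.P K) (K - n) → Matrix (Fin 2) (Fin 2) ℂ,
          (∀ e : PBond (F.P K) (K - n), cf e.src = ((emlIterU (K - n) (bgUnits F K U₁) e : (Matrix (Fin 2) (Fin 2) ℂ)ˣ) : Matrix (Fin 2) (Fin 2) ℂ) * cf e.tgt *
            (((emlIterU (K - n) (bgUnits F K U₁) e)⁻¹ : (Matrix (Fin 2) (Fin 2) ℂ)ˣ) : Matrix (Fin 2) (Fin 2) ℂ)) →
          ∃ l₀ : Site (F.P K) 0 → Matrix (Fin 2) (Fin 2) ℂ,
            (∀ b' : PBond (F.P K) 0, l₀ b'.src = ((bgUnits F K U₁ b' : (Matrix (Fin 2) (Fin 2) ℂ)ˣ) : Matrix (Fin 2) (Fin 2) ℂ) * l₀ b'.tgt * (((bgUnits F K U₁ b')⁻¹ : (Matrix (Fin 2) (Fin 2) ℂ)ˣ) : Matrix (Fin 2) (Fin 2) ℂ)) ∧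
            ∀ y : Site (F.P K) (K - n), l₀ (embIter (K - n) y) = cf y)
    {V : GaugeField (F.P n) 0 (Matrix.specialUnitaryGroup (Fin 2) ℂ)} {U₀ : GaugeField (F.P K) 0 (Matrix.specialUnitaryGroup (Fin 2) ℂ)}
    (hV : PlaqSmall δ V) (hfib : U₀ ∈ fibre F ℰp n K h V) (hreg : RegPr F n K a U₀) :
    ∃ U₁ : GaugeField (F.P K) 0 (Matrix.specialUnitaryGroup (Fin 2) ℂ),
      U₁ ∈ fibre F ℰp n K h V ∧ RegPr F n K a' U₁ ∧ CloseAvg F n K h b V U₁ ∧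
      ∀ cf : Site (F.P K) (K - n) → Matrix (Fin 2) (Fin 2) ℂ,
        (∀ e : PBond (F.P K) (K - n), cf e.src = ((emlIterU (K - n) (bgUnits F K U₁) e : (Matrix (Fin 2) (Fin 2) ℂ)ˣ) : Matrix (Fin 2) (Fin 2) ℂ) * cf e.tgt *
          (((emlIterU (K - n) (bgUnits F K U₁) e)⁻¹ : (Matrix (Fin 2) (Fin 2) ℂ)ˣ) : Matrix (Fin 2) (Fin 2) ℂ)) →
        ∃ l₀ : Site (F.P K) 0 → Matrix (Fin 2) (Fin 2) ℂ,
          (∀ b' : PBond (F.P K) 0, l₀ b'.src = ((bgUnits F K U₁ b' : (Matrix (Fin 2) (Fin 2) ℂ)ˣ) : Matrix (Fin 2) (Fin 2) ℂ) * l₀ b'.tgt * (((bgUnits F K U₁ b')⁻¹ : (Matrix (Fin 2) (Fin 2) ℂ)ˣ) : Matrix (Fin 2) (Fin 2) ℂ)) ∧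
          ∀ y : Site (F.P K) (K - n), l₀ (embIter (K - n) y) = cf y := by
  refine exists_symCentre_of_diagonalSupplier F h ha haW haa' hb (fun V' hdiag hV' => ?_) hV hfib hreg
  rcases parallelConstDiag_or_loopHol_central V' hdiag with hA | ⟨y₀, hcen⟩
  · exact hSup V' hdiag hA hV'
  · obtain ⟨U₁, hfib₁, hreg₁, -, hLift₁⟩ := exists_symCentre_of_loopHol_central F h V' y₀ hcen hδ hV' (ha.trans_le haa') hb
    exact ⟨U₁, hfib₁, hreg₁, hLift₁⟩

/-! ## §2 The supplier may return just a diagonal regular fibre point -/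

/-- ★★★ **`hSymCentre` FROM A DIAGONAL-LIFT SUPPLIER.**  It suffices that for every σ₃-diagonal case-A coarse `V′` with `PlaqSmall δ V′` the supplier returns a
σ₃-DIAGONAL fine field `U₁ ∈ fibre V′` with `RegPr a′ U₁` (`10⁷L³a′ ≤ 1`): its `hLift` is automatic (✓`hLift_of_mem_fibre_of_parallelConstDiag`).  This is the
exact target of the (R4) abelian lift `U₁ := diag(e^{ia}, e^{−ia})`. [cite: Balaban1985Variational, (2)-(7) p.278, (13)-(14) p.280; Balaban1985BackgroundPropagators, (3.21) p.394; Balaban1987RG1, (0.4) p.253] -/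
theorem exists_symCentre_of_diagonalLiftSupplier (h : n ≤ K) {δ a a' b : ℝ} (hδ : δ ≤ 2) (ha : 0 < a) (haW : 10 ^ 7 * (F.L : ℝ) ^ 3 * a ≤ 1)
    (haa' : a ≤ a') (ha'W : 10 ^ 7 * (F.L : ℝ) ^ 3 * a' ≤ 1) (hb : 0 < b)
    (hSup : ∀ V' : GaugeField (F.P n) 0 (Matrix.specialUnitaryGroup (Fin 2) ℂ),
      (∀ e : PBond (F.P n) 0, Commute ((V' e : Matrix.specialUnitaryGroup (Fin 2) ℂ) : Matrix (Fin 2) (Fin 2) ℂ) σ₃) →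
      (∀ c : Site (F.P n) 0 → Matrix (Fin 2) (Fin 2) ℂ,
        (∀ e : PBond (F.P n) 0, c e.src = ((unitsField (toUField V') e : (Matrix (Fin 2) (Fin 2) ℂ)ˣ) : Matrix (Fin 2) (Fin 2) ℂ) * c e.tgt *
          (((unitsField (toUField V') e)⁻¹ : (Matrix (Fin 2) (Fin 2) ℂ)ˣ) : Matrix (Fin 2) (Fin 2) ℂ)) →
        ∃ c₀ : Matrix (Fin 2) (Fin 2) ℂ, (∀ y, c y = c₀) ∧ Commute c₀ σ₃) →
      PlaqSmall δ V' →
      ∃ U₁ : GaugeField (F.P K) 0 (Matrix.specialUnitaryGroup (Fin 2) ℂ), U₁ ∈ fibre F ℰp n K h V' ∧ RegPr F n K a' U₁ ∧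
        ∀ b' : PBond (F.P K) 0, Commute ((U₁ b' : Matrix.specialUnitaryGroup (Fin 2) ℂ) : Matrix (Fin 2) (Fin 2) ℂ) σ₃)
    {V : GaugeField (F.P n) 0 (Matrix.specialUnitaryGroup (Fin 2) ℂ)} {U₀ : GaugeField (F.P K) 0 (Matrix.specialUnitaryGroup (Fin 2) ℂ)}
    (hV : PlaqSmall δ V) (hfib : U₀ ∈ fibre F ℰp n K h V) (hreg : RegPr F n K a U₀) :
    ∃ U₁ : GaugeField (F.P K) 0 (Matrix.specialUnitaryGroup (Fin 2) ℂ),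
      U₁ ∈ fibre F ℰp n K h V ∧ RegPr F n K a' U₁ ∧ CloseAvg F n K h b V U₁ ∧
      ∀ cf : Site (F.P K) (K - n) → Matrix (Fin 2) (Fin 2) ℂ,
        (∀ e : PBond (F.P K) (K - n), cf e.src = ((emlIterU (K - n) (bgUnits F K U₁) e : (Matrix (Fin 2) (Fin 2) ℂ)ˣ) : Matrix (Fin 2) (Fin 2) ℂ) * cf e.tgt *
          (((emlIterU (K - n) (bgUnits F K U₁) e)⁻¹ : (Matrix (Fin 2) (Fin 2) ℂ)ˣ) : Matrix (Fin 2) (Fin 2) ℂ)) →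
        ∃ l₀ : Site (F.P K) 0 → Matrix (Fin 2) (Fin 2) ℂ,
          (∀ b' : PBond (F.P K) 0, l₀ b'.src = ((bgUnits F K U₁ b' : (Matrix (Fin 2) (Fin 2) ℂ)ˣ) : Matrix (Fin 2) (Fin 2) ℂ) * l₀ b'.tgt * (((bgUnits F K U₁ b')⁻¹ : (Matrix (Fin 2) (Fin 2) ℂ)ˣ) : Matrix (Fin 2) (Fin 2) ℂ)) ∧
          ∀ y : Site (F.P K) (K - n), l₀ (embIter (K - n) y) = cf y := by
  refine exists_symCentre_of_abelianSupplier F h hδ ha haW haa' hb (fun V' hdiag hA hV' => ?_) hV hfib hreg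
  obtain ⟨U₁, hfib₁, hreg₁, hU₁⟩ := hSup V' hdiag hA hV'
  exact ⟨U₁, hfib₁, hreg₁, hLift_of_mem_fibre_of_parallelConstDiag F h (ha.trans_le haa') ha'W hfib₁ hreg₁ hU₁ hA⟩

end T3

end Summit.QuantumFields.YangMills.Theorems.Prop7NestedMeanParallelLiftDiagGauge

end
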